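import Mathlib

/-!
# Route BarrierLever — item `PartitionMinorsHitByVP` (stmt-ValiantsHypothesis-19717), line `hidden_states`:
# THE SYM²-SYZYGY LAW — second differences of a pair block weighted by a symmetric syzygy matrix vanish on rows of size ≤ 3

Helper file (`--supports stmt-ValiantsHypothesis-19717`; cell valiant-natproofs, rung V4, 𝒟-side door (c), line `hidden_states`,
node #1 `stub_universalJoinWide`; prover seat val-np-p3 gen 22; memo HOME/val-np-p3/g22/MEMO-girth-valnp3-g22.md §8). Definition-light
(bookkeeping `def`s `pt0/pt1/pt2`, `secondDiff`, `colVal`, `relVec` only). Closes NO item: it is a LAW of the line (a circuit family of the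
generic row matroid of a pair block, in the language of `…HiddenStatesGirth`), the mechanism behind — and a sharpening of — the `q = 1`
pair-span law of `…HiddenStatesShadowRankPairs`.

THE LAW. One table (`tx none` = origin `o`, `tx (some p)` = state `g_p`), a set `S` of states, a set `T` of coordinates. Call
`β : S × S → ℂ` a SYMMETRIC SYZYGY MATRIX if it is symmetric and every column is a syzygy of the states on `T`:
`Σ_{p ∈ S} β p p' · g_p(a) = 0` for all `p' ∈ S`, `a ∈ T`. Then for every row `U ⊆ T` with `|U| ≤ 3`

  `Σ_{p,p' ∈ S} β p p' · [x^U(o+g_p+g_p') − x^U(o+g_p) − x^U(o+g_p') + x^U(o)] = 0`            (`sum_secondDiff_eq_zero`)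

(the second difference of `x^U = ∏_{a∈U} x_a`, `|U| ≤ 3`, is a sum of twelve / two monomials each LINEAR in `g_p` or in `g_{p'}` at a single
coordinate of `T`; summing that factor against `β` gives a syzygy). Consequently (`det_eq_zero_of_syzygy`): if the column family of the
block-additive matrix `[∏_{a ∈ u i}(tx none a + Σ_{q ∈ e k} tx (some q) a)]` contains the origin `∅`, the singletons `{p}` and all pairs `{p,p'}`
of `S` (a complete pair ball on `S` with its origin, among possibly other columns), all rows lie in `B₃(T)`, and a NONZERO symmetric syzygy
matrix with ZERO DIAGONAL exists, then the matrix is SINGULAR FOR THAT TABLE — the explicit kernel vector `relVec` puts `2β p p'` on the pair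
column `{p,p'}`, `−2 Σ_{p'} β p p'` on `{p}` and `Σ β` on `∅` (`mulVec_relVec`, `relVec_ne_zero`).

HOW MANY SUCH β (memo §8). For EVERY table the syzygy space `Λ_T = {λ : Σ_p λ_p g_p|_T = 0}` has dimension `≥ |S| − |T|`, and
`Sym²(Λ_T) ∩ {diag = 0}` consists of symmetric syzygy matrices with zero diagonal, of dimension `≥ C(|S|−|T|+1, 2) − |S|`. So on rows inside
`B₃(T)` a pair block on `b` states with origin has rank `≤ N_b − (C(b−t+1,2) − b)` — BELOW the `q = 1` pair-span bound (`b(t+2) − C(t+1,2)` for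
the span of the PAIR columns, which is exact) by exactly `b − t`, the dimension in which the pair-column span meets the span of the origin and
singleton columns. Kit j333612 (n = t = 9..12; 13 single blocks in and around the band): rank EQUALS `N_b − (C(b−t+1,2) − b)` in every case,
and for 2- and 3-block JOINS of such law-deficient saturated blocks the ranks ADD (joint rank = min(#rows, Σ ranks)). The dimension count is
NOT formalised here (this file takes the nonzero `β` as a hypothesis).

WHAT THIS IS NOT: no statement about joins (additivity is empirical); item 19717 stays OPEN; nothing on crux 14610 or VP ≠ VNP, which is NOT proved.
-/

set_option linter.dupNamespace false

namespace Summit.ValiantsHypothesis.ValiantsHypothesis.Theorems.BarrierLever.HiddenStates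

open Finset Matrix

noncomputable section

namespace SymSyzygy

variable {h K : ℕ}

/-! ## 1. Formal points and the second difference -/

/-- Origin coordinate. -/
def pt0 (tx : Option (Fin K) → Fin h → ℂ) (a : Fin h) : ℂ := tx none a

/-- Axis point `o + g_p`, coordinate `a`. -/
def pt1 (tx : Option (Fin K) → Fin h → ℂ) (p : Fin K) (a : Fin h) : ℂ := tx none a + tx (some p) a

/-- Formal pair point `o + g_p + g_{p'}`, coordinate `a` (for `p ≠ p'` this is the point of the column `{p, p'}`). -/
def pt2 (tx : Option (Fin K) → Fin h → ℂ) (p p' : Fin K) (a : Fin h) : ℂ := tx none a + tx (some p) a + tx (some p') a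

/-- The (formal) second difference of the monomial `x^U` at the origin along the states `p, p'`. -/
def secondDiff (tx : Option (Fin K) → Fin h → ℂ) (U : Finset (Fin h)) (p p' : Fin K) : ℂ :=
  ∏ a ∈ U, pt2 tx p p' a - ∏ a ∈ U, pt1 tx p a - ∏ a ∈ U, pt1 tx p' a + ∏ a ∈ U, pt0 tx a

section law

variable (tx : Option (Fin K) → Fin h → ℂ) (S : Finset (Fin K)) (T : Finset (Fin h)) (β : Fin K → Fin K → ℂ)
  (hsym : ∀ p ∈ S, ∀ p' ∈ S, β p p' = β p' p)
  (hΛ : ∀ p' ∈ S, ∀ a ∈ T, ∑ p ∈ S, β p p' * tx (some p) a = 0)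
include hsym hΛ

omit hsym in
/-- Terms linear in `g_p` at a coordinate of `T` die. -/
theorem sum_linL_eq_zero {a : Fin h} (ha : a ∈ T) (R : Fin K → ℂ) :
    ∑ p ∈ S, ∑ p' ∈ S, β p p' * (tx (some p) a * R p') = 0 := by
  rw [Finset.sum_comm]
  refine Finset.sum_eq_zero fun p' hp' => ?_
  have hz := hΛ p' hp' a ha
  calc ∑ p ∈ S, β p p' * (tx (some p) a * R p')
      = (∑ p ∈ S, β p p' * tx (some p) a) * R p' := by
        rw [Finset.sum_mul]; exact Finset.sum_congr rfl fun p _ => by ring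
    _ = 0 := by rw [hz, zero_mul]

/-- Terms linear in `g_{p'}` at a coordinate of `T` die (by symmetry of `β`). -/
theorem sum_linR_eq_zero {a : Fin h} (ha : a ∈ T) (R : Fin K → ℂ) :
    ∑ p ∈ S, ∑ p' ∈ S, β p p' * (R p * tx (some p') a) = 0 := by
  refine Finset.sum_eq_zero fun p hp => ?_
  have hz := hΛ p hp a ha
  calc ∑ p' ∈ S, β p p' * (R p * tx (some p') a)
      = R p * ∑ p' ∈ S, β p' p * tx (some p') a := by
        rw [Finset.mul_sum]
        exact Finset.sum_congr rfl fun p' hp' => by rw [hsym p hp p' hp']; ring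
    _ = 0 := by rw [hz, mul_zero]

/-- **THE SYM²-SYZYGY LAW.** For a symmetric syzygy matrix `β` and a row `U ⊆ T` of size `≤ 3`,
`Σ_{p,p' ∈ S} β p p' · secondDiff U p p' = 0`. -/
theorem sum_secondDiff_eq_zero (U : Finset (Fin h)) (hUT : U ⊆ T) (hU : U.card ≤ 3) :
    ∑ p ∈ S, ∑ p' ∈ S, β p p' * secondDiff tx U p p' = 0 := by
  classical
  have hcases : U.card = 0 ∨ U.card = 1 ∨ U.card = 2 ∨ U.card = 3 := by omega
  rcases hcases with h0 | h1 | h2 | h3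
  · -- |U| = 0
    rw [Finset.card_eq_zero] at h0
    subst h0
    simp [secondDiff]
  · -- |U| = 1 : the second difference of a linear monomial vanishes
    obtain ⟨a, rfl⟩ := Finset.card_eq_one.mp h1
    have key : ∀ p p', secondDiff tx {a} p p' = 0 := by
      intro p p'; simp only [secondDiff, Finset.prod_singleton, pt0, pt1, pt2]; ring
    simp [key]
  · -- |U| = 2
    obtain ⟨a, c, hac, rfl⟩ := Finset.card_eq_two.mp h2
    have ha : a ∈ T := hUT (by simp)
    have hc : c ∈ T := hUT (by simp)
    have hnot : a ∉ ({c} : Finset (Fin h)) := by simpa using hac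
    have key : ∀ p p', secondDiff tx {a, c} p p' =
        tx (some p) a * tx (some p') c + tx (some p) c * tx (some p') a := by
      intro p p'
      simp only [secondDiff, Finset.prod_insert hnot, Finset.prod_singleton, pt0, pt1, pt2]
      ring
    have e1 : ∑ p ∈ S, ∑ p' ∈ S, β p p' * (tx (some p) a * tx (some p') c) = 0 :=
      sum_linL_eq_zero tx S T β hΛ ha (fun p' => tx (some p') c)
    have e2 : ∑ p ∈ S, ∑ p' ∈ S, β p p' * (tx (some p) c * tx (some p') a) = 0 :=
      sum_linL_eq_zero tx S T β hΛ hc (fun p' => tx (some p') a)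
    simp only [key, mul_add, Finset.sum_add_distrib]
    linear_combination e1 + e2
  · -- |U| = 3
    obtain ⟨a, c, d, hac, had, hcd, rfl⟩ := Finset.card_eq_three.mp h3
    have ha : a ∈ T := hUT (by simp)
    have hc : c ∈ T := hUT (by simp)
    have hd : d ∈ T := hUT (by simp)
    have hnot1 : a ∉ ({c, d} : Finset (Fin h)) := by simp [hac, had]
    have hnot2 : c ∉ ({d} : Finset (Fin h)) := by simpa using hcd
    have key : ∀ p p', secondDiff tx {a, c, d} p p' =
        tx (some p) a * (tx (some p') c * tx (some p') d)
        + tx (some p) c * (tx (some p') a * tx (some p') d)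
        + tx (some p) d * (tx (some p') a * tx (some p') c)
        + (tx (some p) c * tx (some p) d) * tx (some p') a
        + (tx (some p) a * tx (some p) d) * tx (some p') c
        + (tx (some p) a * tx (some p) c) * tx (some p') d
        + tx (some p) c * (tx none a * tx (some p') d)
        + tx (some p) d * (tx none a * tx (some p') c)
        + tx (some p) a * (tx none c * tx (some p') d)
        + tx (some p) d * (tx none c * tx (some p') a)
        + tx (some p) a * (tx none d * tx (some p') c)
        + tx (some p) c * (tx none d * tx (some p') a) := by
      intro p p'
      simp only [secondDiff, Finset.prod_insert hnot1, Finset.prod_insert hnot2, Finset.prod_singleton, pt0, pt1, pt2]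
      ring
    have e1 := sum_linL_eq_zero tx S T β hΛ ha (fun p' => tx (some p') c * tx (some p') d)
    have e2 := sum_linL_eq_zero tx S T β hΛ hc (fun p' => tx (some p') a * tx (some p') d)
    have e3 := sum_linL_eq_zero tx S T β hΛ hd (fun p' => tx (some p') a * tx (some p') c)
    have e4 := sum_linR_eq_zero tx S T β hsym hΛ ha (fun p => tx (some p) c * tx (some p) d)
    have e5 := sum_linR_eq_zero tx S T β hsym hΛ hc (fun p => tx (some p) a * tx (some p) d)
    have e6 := sum_linR_eq_zero tx S T β hsym hΛ hd (fun p => tx (some p) a * tx (some p) c)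
    have e7 := sum_linL_eq_zero tx S T β hΛ hc (fun p' => tx none a * tx (some p') d)
    have e8 := sum_linL_eq_zero tx S T β hΛ hd (fun p' => tx none a * tx (some p') c)
    have e9 := sum_linL_eq_zero tx S T β hΛ ha (fun p' => tx none c * tx (some p') d)
    have e10 := sum_linL_eq_zero tx S T β hΛ hd (fun p' => tx none c * tx (some p') a)
    have e11 := sum_linL_eq_zero tx S T β hΛ ha (fun p' => tx none d * tx (some p') c)
    have e12 := sum_linL_eq_zero tx S T β hΛ hc (fun p' => tx none d * tx (some p') a)
    simp only [key, mul_add, Finset.sum_add_distrib]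
    linear_combination e1 + e2 + e3 + e4 + e5 + e6 + e7 + e8 + e9 + e10 + e11 + e12

end law

/-! ## 2. The column relation and the vanishing determinant -/

section det

variable {n : Type*} [Fintype n]

/-- The value of the (possibly absent) column with state set `J` on the row `U`: `∏_{a ∈ U} (tx none a + Σ_{q ∈ J} tx (some q) a)`. -/
def colVal (tx : Option (Fin K) → Fin h → ℂ) (U : Finset (Fin h)) (J : Finset (Fin K)) : ℂ :=
  ∏ a ∈ U, (tx none a + ∑ q ∈ J, tx (some q) a)

/-- Summing a column-indexed quantity against the indicator of `e k = J` picks the column `J` (injective `e`, `J` present). -/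
theorem sum_ite_col_eq (e : n → Finset (Fin K)) (he : Function.Injective e) {J : Finset (Fin K)} (hJ : ∃ k, e k = J)
    (f : n → ℂ) : ∑ k, (if e k = J then f k else 0) = f hJ.choose := by
  classical
  have hk₀ := hJ.choose_spec
  rw [Finset.sum_eq_single hJ.choose]
  · rw [if_pos hk₀]
  · intro k _ hk
    rw [if_neg]
    intro hkJ
    exact hk (he (hkJ.trans hk₀.symm))
  · intro habs; exact absurd (Finset.mem_univ _) habs

/-- The kernel vector of the law: `Σ_{p,p'} β p p' (χ_{e k = {p,p'}} − χ_{e k = {p}} − χ_{e k = {p'}} + χ_{e k = ∅})`. -/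
def relVec (e : n → Finset (Fin K)) (S : Finset (Fin K)) (β : Fin K → Fin K → ℂ) : n → ℂ :=
  fun k => ∑ p ∈ S, ∑ p' ∈ S, β p p' *
    ((if e k = insert p {p'} then 1 else 0) - (if e k = {p} then 1 else 0) - (if e k = {p'} then 1 else 0) +
      (if e k = ∅ then 1 else 0))

variable (tx : Option (Fin K) → Fin h → ℂ) (u : n → Finset (Fin h)) (e : n → Finset (Fin K)) (he : Function.Injective e)
  (S : Finset (Fin K)) (T : Finset (Fin h)) (β : Fin K → Fin K → ℂ)
  (h0 : ∃ k, e k = ∅) (h1 : ∀ p ∈ S, ∃ k, e k = {p})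
  (h2 : ∀ p ∈ S, ∀ p' ∈ S, p ≠ p' → ∃ k, e k = insert p {p'})

omit [Fintype n] in
/-- The block-additive matrix of the line: `M i k = ∏_{a ∈ u i} (tx none a + Σ_{q ∈ e k} tx (some q) a)`. -/
theorem matrix_apply (i k : n) :
    (Matrix.of fun i k : n => ∏ a ∈ u i, (tx none a + ∑ q ∈ e k, tx (some q) a)) i k = colVal tx (u i) (e k) := rfl

include he in
/-- Pairing a row with the indicator of a present column gives that column's value. -/
theorem sum_row_ite (i : n) {J : Finset (Fin K)} (hJ : ∃ k, e k = J) :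
    ∑ k, colVal tx (u i) (e k) * (if e k = J then (1 : ℂ) else 0) = colVal tx (u i) J := by
  classical
  have hrw : ∀ k, colVal tx (u i) (e k) * (if e k = J then (1 : ℂ) else 0) =
      if e k = J then colVal tx (u i) (e k) else 0 := by
    intro k; split_ifs <;> simp
  simp_rw [hrw]
  rw [sum_ite_col_eq e he hJ]
  rw [hJ.choose_spec]

/-- Column values at the four sets are the formal points (for `p ≠ p'`). -/
theorem colVal_pair (U : Finset (Fin h)) {p p' : Fin K} (hpp' : p ≠ p') :
    colVal tx U (insert p {p'}) = ∏ a ∈ U, pt2 tx p p' a := by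
  unfold colVal pt2
  refine Finset.prod_congr rfl fun a _ => ?_
  rw [Finset.sum_insert (by simpa using hpp'), Finset.sum_singleton, add_assoc]

/-- The singleton column `{p}` is the axis point `o + g_p`. -/
theorem colVal_single (U : Finset (Fin h)) (p : Fin K) : colVal tx U {p} = ∏ a ∈ U, pt1 tx p a := by
  unfold colVal pt1; simp

/-- The empty column is the origin. -/
theorem colVal_empty (U : Finset (Fin h)) : colVal tx U ∅ = ∏ a ∈ U, pt0 tx a := by
  unfold colVal pt0; simp

include he h0 h1 h2 in
/-- **The matrix kills the relation vector** on every row inside `B₃(T)`, for a symmetric syzygy matrix with zero diagonal. -/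
theorem mulVec_relVec (hsym : ∀ p ∈ S, ∀ p' ∈ S, β p p' = β p' p) (hdiag : ∀ p ∈ S, β p p = 0)
    (hΛ : ∀ p' ∈ S, ∀ a ∈ T, ∑ p ∈ S, β p p' * tx (some p) a = 0)
    (hrows : ∀ i, u i ⊆ T ∧ (u i).card ≤ 3) :
    (Matrix.of fun i k : n => ∏ a ∈ u i, (tx none a + ∑ q ∈ e k, tx (some q) a)) *ᵥ relVec e S β = 0 := by
  classical
  funext i
  rw [Pi.zero_apply, Matrix.mulVec, dotProduct]
  simp only [matrix_apply]
  -- push the column sum inside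
  have hstep : ∑ k, colVal tx (u i) (e k) * relVec e S β k =
      ∑ p ∈ S, ∑ p' ∈ S, β p p' *
        (colVal tx (u i) (insert p {p'}) - colVal tx (u i) {p} - colVal tx (u i) {p'} + colVal tx (u i) ∅) := by
    unfold relVec
    simp_rw [Finset.mul_sum]
    rw [Finset.sum_comm]
    refine Finset.sum_congr rfl fun p hp => ?_
    rw [Finset.sum_comm]
    refine Finset.sum_congr rfl fun p' hp' => ?_
    have hpair : ∃ k, e k = insert p {p'} := by
      by_cases hpp : p = p'
      · subst hpp
        simpa using h1 p hp
      · exact h2 p hp p' hp' hpp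
    have hA := sum_row_ite tx u e he i hpair
    have hB := sum_row_ite tx u e he i (h1 p hp)
    have hC := sum_row_ite tx u e he i (h1 p' hp')
    have hD := sum_row_ite tx u e he i h0
    have hsplit : ∀ k, colVal tx (u i) (e k) * (β p p' *
        ((if e k = insert p {p'} then 1 else 0) - (if e k = {p} then 1 else 0) - (if e k = {p'} then 1 else 0) +
          (if e k = ∅ then 1 else 0))) =
        β p p' * (colVal tx (u i) (e k) * (if e k = insert p {p'} then (1:ℂ) else 0)
          - colVal tx (u i) (e k) * (if e k = {p} then (1:ℂ) else 0)
          - colVal tx (u i) (e k) * (if e k = {p'} then (1:ℂ) else 0)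
          + colVal tx (u i) (e k) * (if e k = ∅ then (1:ℂ) else 0)) := by
      intro k; ring
    simp_rw [hsplit]
    rw [← Finset.mul_sum, Finset.sum_add_distrib, Finset.sum_sub_distrib, Finset.sum_sub_distrib, hA, hB, hC, hD]
  rw [hstep]
  -- replace each bracket by the formal second difference (the diagonal carries β p p = 0)
  have hbr : ∀ p ∈ S, ∀ p' ∈ S, β p p' *
      (colVal tx (u i) (insert p {p'}) - colVal tx (u i) {p} - colVal tx (u i) {p'} + colVal tx (u i) ∅) =
      β p p' * secondDiff tx (u i) p p' := by
    intro p hp p' hp'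
    by_cases hpp : p = p'
    · subst hpp; rw [hdiag p hp, zero_mul, zero_mul]
    · rw [secondDiff, colVal_pair tx (u i) hpp, colVal_single, colVal_single, colVal_empty]
  rw [Finset.sum_congr rfl fun p hp => Finset.sum_congr rfl fun p' hp' => hbr p hp p' hp']
  exact sum_secondDiff_eq_zero tx S T β hsym hΛ (u i) (hrows i).1 (hrows i).2

/-- Two-element sets: `{p, p'} = {p₀, p₀'}` with `p₀ ≠ p₀'` forces `(p, p') ∈ {(p₀, p₀'), (p₀', p₀)}`. -/
theorem pair_eq_pair {p p' p₀ p₀' : Fin K} (hne : p₀ ≠ p₀') (heq : insert p ({p'} : Finset (Fin K)) = insert p₀ {p₀'}) :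
    (p = p₀ ∧ p' = p₀') ∨ (p = p₀' ∧ p' = p₀) := by
  have hp : p ∈ insert p₀ ({p₀'} : Finset (Fin K)) := by rw [← heq]; simp
  have hp' : p' ∈ insert p₀ ({p₀'} : Finset (Fin K)) := by rw [← heq]; simp
  have hp₀ : p₀ ∈ insert p ({p'} : Finset (Fin K)) := by rw [heq]; simp
  have hp₀' : p₀' ∈ insert p ({p'} : Finset (Fin K)) := by rw [heq]; simp
  simp only [Finset.mem_insert, Finset.mem_singleton] at hp hp' hp₀ hp₀'
  rcases hp with rfl | rfl <;> rcases hp' with h' | h'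
  · subst h'; rcases hp₀' with h'' | h'' <;> exact absurd h''.symm hne
  · exact Or.inl ⟨rfl, h'⟩
  · exact Or.inr ⟨rfl, h'⟩
  · subst h'; rcases hp₀ with h'' | h'' <;> exact absurd h'' hne

omit [Fintype n] in
include h2 in
/-- **The relation vector is nonzero** as soon as `β` (zero diagonal) has a nonzero entry on `S × S`: its value on the pair column
`{p₀, p₀'}` is `2 β p₀ p₀'`. -/
theorem relVec_ne_zero (hsym : ∀ p ∈ S, ∀ p' ∈ S, β p p' = β p' p) (hdiag : ∀ p ∈ S, β p p = 0)
    (hne : ∃ p ∈ S, ∃ p' ∈ S, β p p' ≠ 0) : relVec e S β ≠ 0 := by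
  classical
  obtain ⟨p₀, hp₀, p₀', hp₀', hβ⟩ := hne
  have hpp : p₀ ≠ p₀' := by
    intro h; subst h; exact hβ (hdiag p₀ hp₀)
  obtain ⟨k₀, hk₀⟩ := h2 p₀ hp₀ p₀' hp₀' hpp
  have hcard : (e k₀).card = 2 := by rw [hk₀, Finset.card_insert_of_notMem (by simpa using hpp), Finset.card_singleton]
  intro hzero
  have hk : relVec e S β k₀ = 0 := by rw [hzero]; rfl
  -- evaluate the relation vector at the pair column
  have hsingle : ∀ p, (if e k₀ = ({p} : Finset (Fin K)) then (1:ℂ) else 0) = 0 := by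
    intro p; rw [if_neg]; intro h; rw [h, Finset.card_singleton] at hcard; exact absurd hcard (by norm_num)
  have hempty : (if e k₀ = (∅ : Finset (Fin K)) then (1:ℂ) else 0) = 0 := by
    rw [if_neg]; intro h; rw [h, Finset.card_empty] at hcard; exact absurd hcard (by norm_num)
  have hval : relVec e S β k₀ = ∑ p ∈ S, ∑ p' ∈ S, β p p' * (if e k₀ = insert p {p'} then 1 else 0) := by
    unfold relVec
    refine Finset.sum_congr rfl fun p _ => Finset.sum_congr rfl fun p' _ => ?_
    rw [hsingle p, hsingle p', hempty]; ring
  rw [hval, hk₀] at hk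
  -- only (p₀,p₀') and (p₀',p₀) contribute
  rw [← Finset.sum_product'] at hk
  rw [Finset.sum_eq_add (p₀, p₀') (p₀', p₀)] at hk
  · simp only [if_true] at hk
    have hins : insert p₀ ({p₀'} : Finset (Fin K)) = insert p₀' {p₀} := Finset.pair_comm p₀ p₀'
    rw [if_pos hins, hsym p₀' hp₀' p₀ hp₀] at hk
    have : (2 : ℂ) * β p₀ p₀' = 0 := by linear_combination hk
    exact hβ (by simpa using this)
  · intro heq; exact hpp (Prod.mk.inj heq).1
  · intro c hc hne'
    have hc' : ¬ (insert p₀ ({p₀'} : Finset (Fin K)) = insert c.1 {c.2}) := by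
      intro heq
      rcases pair_eq_pair hpp heq.symm with ⟨h1', h2'⟩ | ⟨h1', h2'⟩
      · exact hne'.1 (Prod.ext h1' h2')
      · exact hne'.2 (Prod.ext h1' h2')
    rw [if_neg hc', mul_zero]
  · intro habs; exact absurd (Finset.mem_product.mpr ⟨hp₀, hp₀'⟩) habs
  · intro habs; exact absurd (Finset.mem_product.mpr ⟨hp₀', hp₀⟩) habs

include he h0 h1 h2 in
/-- **THE SYM²-SYZYGY LAW AS A VANISHING DETERMINANT.** Rows inside `B₃(T)`; columns containing the complete pair ball on `S` with its
origin; a nonzero symmetric syzygy matrix on `S × T` with zero diagonal ⇒ the block-additive matrix is singular for this table. -/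
theorem det_eq_zero_of_syzygy [DecidableEq n] (hsym : ∀ p ∈ S, ∀ p' ∈ S, β p p' = β p' p) (hdiag : ∀ p ∈ S, β p p = 0)
    (hΛ : ∀ p' ∈ S, ∀ a ∈ T, ∑ p ∈ S, β p p' * tx (some p) a = 0) (hne : ∃ p ∈ S, ∃ p' ∈ S, β p p' ≠ 0)
    (hrows : ∀ i, u i ⊆ T ∧ (u i).card ≤ 3) :
    (Matrix.of fun i k : n => ∏ a ∈ u i, (tx none a + ∑ q ∈ e k, tx (some q) a)).det = 0 := by
  classical
  exact Matrix.exists_mulVec_eq_zero_iff.mp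
    ⟨relVec e S β, relVec_ne_zero e S β h2 hsym hdiag hne, mulVec_relVec tx u e he S T β h0 h1 h2 hsym hdiag hΛ hrows⟩

end det

end SymSyzygy

end

end Summit.ValiantsHypothesis.ValiantsHypothesis.Theorems.BarrierLever.HiddenStates
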